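import Summits.QuantumFields.YangMills.Theorems.AllWindowsColdBoxBoxHighLineLandauDivergence
import Literature.Probability.LatticeModels.DirichletGreenFunction

/-!
# The Gram matrix of the gauge modes is the Dirichlet Laplacian of the interior box

Route `AllWindowsColdBox`, LINE-19 S3 / LINE-20 U1 (crux ⟨stmt-QuantumFields-24336⟩, parent ⟨24004⟩; STUB-PLAN-U1 rev 2 §6, gradient block (A)):
the operator `Δ_I = (d₀ᴵ)ᵀd₀ᴵ` of ✓`…DipoleKernelProjection` (T-U1.G) is, entry by entry, the tree's Dirichlet Laplacian matrix of the interior box: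

* **`gradVec_dotProduct_gradVec`** — for interior sites `x, y`: `g_x · g_y = dirichletMatrix (interiorSites H) x y`
  (`= 8` if `x = y`, `−1` if `x ∼ y`, `0` otherwise), so `Δ_I⁻¹ = dirichletGreen (interiorSites H)` = the 16-image torus sum of
  ✓`…BoxImageFormula`.

Everything proved; no definitions; standard axioms.  HONEST LABEL: glue toward the kernel stubs of two critic-stamped DRAFT lines; no stub, crux, rung
or summit is proved; the Yang–Mills mass gap is NOT proved by this file.
-/

set_option autoImplicit false

noncomputable section

namespace Summit.QuantumFields.YangMills.Theorems.AllWindowsColdBoxBoxHighLine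

open Finset Matrix
open Literature.Probability.LatticeModels

variable {H : ℕ}

/-- `x + e_μ = x + e_i ↔ μ = i` for unit vectors of `ℤ⁴`. -/
theorem single_one_eq_single_one_iff (μ i : Fin 4) : (Pi.single μ (1 : ℤ) : Site 4) = Pi.single i 1 ↔ μ = i := by
  constructor
  · intro h
    by_contra hne
    have := congrFun h μ
    simp [Pi.single_eq_of_ne hne] at this
  · rintro rfl; rfl

/-- `−e_μ ≠ e_i` in `ℤ⁴`. -/
theorem neg_single_one_ne_single_one (μ i : Fin 4) : -(Pi.single μ (1 : ℤ) : Site 4) ≠ Pi.single i 1 := by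
  intro h
  have := congrFun h μ
  by_cases hμ : μ = i
  · subst hμ; simp at this
  · simp [Pi.single_eq_of_ne hμ] at this

/-- **The Gram matrix of the gauge modes is the Dirichlet Laplacian matrix of the interior box**:
`gradVec x · gradVec y = dirichletMatrix (interiorSites H) x y` for interior `x, y`. -/
theorem gradVec_dotProduct_gradVec {x y : Site 4} (hx : x ∈ interiorSites H) (hy : y ∈ interiorSites H) :
    gradVec H x ⬝ᵥ gradVec H y = dirichletMatrix (interiorSites H) ⟨x, hx⟩ ⟨y, hy⟩ := by
  rw [gradVec_dotProduct_eq_interior hx]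
  -- the entries of `g_y` on the in/out edges at `x`
  have hin : ∀ μ : Fin 4, gradVec H y (inEdge hx μ) =
      (if x = y then (1 : ℝ) else 0) - (if x - Pi.single μ 1 = y then 1 else 0) := by
    intro μ
    simp only [gradVec, inEdge, sub_add_cancel]
    split_ifs <;> norm_num
  have hout : ∀ μ : Fin 4, gradVec H y (outEdge hx μ) =
      (if x + Pi.single μ 1 = y then (1 : ℝ) else 0) - (if x = y then 1 else 0) := by
    intro μ
    simp only [gradVec, outEdge]
    split_ifs <;> norm_num
  simp only [hin, hout, Finset.sum_sub_distrib, Finset.sum_const, Finset.card_univ, Fintype.card_fin]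
  unfold dirichletMatrix
  by_cases hxy : x = y
  · subst hxy
    have h1 : ∀ μ : Fin 4, ¬ (x - Pi.single μ 1 = x) := fun μ h => by
      have := congrFun h μ; simp at this
    have h2 : ∀ μ : Fin 4, ¬ (x + Pi.single μ 1 = x) := fun μ h => by
      have := congrFun h μ; simp at this
    simp [h1, h2]
    norm_num
  · have hne : (⟨x, hx⟩ : ↥(interiorSites H)) ≠ ⟨y, hy⟩ := fun h => hxy (Subtype.ext_iff.1 h)
    simp only [hxy, if_false, hne]
    by_cases hadj' : (zdGraph 4).Adj x y
    · rw [if_pos hadj']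
      obtain ⟨i, hi | hi⟩ := (zdGraph_adj_iff x y).1 hadj'
      · -- `y = x + e_i`: only the out-edge in direction `i` contributes
        have hm : ∀ μ : Fin 4, ¬ (x - Pi.single μ 1 = y) := by
          intro μ h
          rw [hi, sub_eq_add_neg, add_right_inj] at h
          exact neg_single_one_ne_single_one μ i h
        have hp : ∀ μ : Fin 4, (x + Pi.single μ 1 = y) ↔ μ = i := by
          intro μ; rw [hi, add_right_inj, single_one_eq_single_one_iff]
        simp only [hm, if_false, hp, Finset.sum_const_zero, Finset.sum_ite_eq', Finset.mem_univ, if_true]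
        norm_num
      · -- `x = y + e_i`: only the in-edge in direction `i` contributes
        have hp : ∀ μ : Fin 4, ¬ (x + Pi.single μ 1 = y) := by
          intro μ h
          rw [hi, add_assoc, add_eq_left] at h
          have := congrFun h i
          by_cases hμ : μ = i
          · subst hμ; simp at this
          · simp [Pi.single_eq_of_ne (Ne.symm hμ)] at this
        have hm : ∀ μ : Fin 4, (x - Pi.single μ 1 = y) ↔ μ = i := by
          intro μ; rw [hi, add_sub_assoc, add_eq_left, sub_eq_zero, eq_comm, single_one_eq_single_one_iff, eq_comm]
        simp only [hp, if_false, hm, Finset.sum_const_zero, Finset.sum_ite_eq', Finset.mem_univ, if_true]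
        norm_num
    · rw [if_neg hadj']
      have hadj : ∀ i : Fin 4, ¬ (y = x + Pi.single i 1) ∧ ¬ (x = y + Pi.single i 1) := by
        intro i
        constructor <;> intro h <;> exact hadj' ((zdGraph_adj_iff x y).2 ⟨i, by tauto⟩)
      have hm : ∀ μ : Fin 4, ¬ (x - Pi.single μ 1 = y) := fun μ h => (hadj μ).2 (by rw [← h, sub_add_cancel])
      have hp : ∀ μ : Fin 4, ¬ (x + Pi.single μ 1 = y) := fun μ h => (hadj μ).1 h.symm
      simp [hm, hp]

end Summit.QuantumFields.YangMills.Theorems.AllWindowsColdBoxBoxHighLine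

end
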